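import Summits.Parity.BatemanHorn.Theorems.SelbergDelangeRigidityLSDRealSegmentTailsTwoPrintedEngine
import Summits.Parity.BatemanHorn.Theorems.SelbergDelangeRigidityLSDRealSegmentTailsTwoAPrioriOfEngine
import Summits.Parity.BatemanHorn.Theorems.SelbergDelangeRigidityLSDRealSegmentTailsTwoRankinOfEngine
import Summits.Parity.BatemanHorn.Theorems.SelbergDelangeRigidityLSDRealSegmentTailsTwoTopOfEngine
import Summits.Parity.BatemanHorn.Theorems.SelbergDelangeRigidityLSDRealSegmentTailsTwoBalQOfEngine
import Summits.Parity.BatemanHorn.Theorems.SelbergDelangeRigidityLSDRealSegmentTailsTwoBal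
import HarnessLib

/-!
# Route `SelbergDelangeRigidity`, crux `LSDRealSegment` (stmt-Parity-9770), line
# `product-anatomy-subcritical`: `stub_tailsTwo` RE-BASED on the printed Nair–Tenenbaum Theorem 1

The landed conditional form `stub_tailsTwo_of_facts` (`…TailsTwoBal.lean`) of the stub `stub_tailsTwo` — the four tilted
tail bounds `APrioriBound`, `RankinTail`, `TopClassBound`, `BalancedClassBound` for every Bateman–Horn system of total
degree `2` (one irreducible quadratic, or two non-associated linear forms) and every `1 ≤ y < 2` — assumes two named
facts: (NT) `Literature.NumberTheory.Sieve.NairTenenbaum1998_theorem1`, which is MISSTATED (Erratum 2 of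
`Literature/NumberTheory/Sieve/NairTenenbaumShortSums.lean`: it transcribes Henriot's range `0 < α < 1`, whereas the
printed Theorem 1 of Nair–Tenenbaum, Acta Math. 180 (1998) p. 125, gives Henriot's form only for `0 < α < 1/2`) and
will not be discharged as stated, and (R) `BugeaudEvertseGyory2018_SPartPolynomialValues`, now PROVED in the tree
(`Literature.NumberTheory.DiophantineApproximation.BugeaudEvertseGyory2018_SPartPolynomialValues_holds`).  The chain
uses (NT) only at `α = 1/4`, inside the small-prime restoration engine; `…TailsTwoPrintedEngine.lean` re-proves the
engine (`tailsTwo_engine_printed`) on the CORRECTED named fact `Literature.NumberTheory.Sieve.NairTenenbaum1998_theorem1_printed`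
(the printed theorem; Henriot's form on `α < 1/2` by the proved bridge `NairTenenbaum1998_theorem1_printed.henriotForm`)
with (R) discharged, and `…TailsTwo{APriori,Rankin,Top,BalQ}OfEngine.lean` prove the four clauses UNCONDITIONALLY from
the engine bound taken as a hypothesis.  This file assembles them:

* `tailsTwo_aPrioriBound_printed`, `tailsTwo_rankinTail_printed`, `tailsTwo_topClassBound_printed`,
  `tailsTwo_balanced_quadratic_printed`: clauses (a), (b), (c), and (d) for one quadratic, on
  `NairTenenbaum1998_theorem1_printed` (the `…_of_engine` lemmas fed with `tailsTwo_engine_printed`).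
* `tailsTwo_balancedClassBound_printed`: clause (d) for every system of total degree `2` (linear pair: the balanced
  class lies inside the top class, `balanced_subset_top_of_linear`, so clause (c) applies with `η = δ`).
* `stub_tailsTwo_of_NT_printed` (registered helper): THE CONDITIONAL FORM OF THE STUB on the single honest named fact
  `NairTenenbaum1998_theorem1_printed`.
* `stub_tailsTwo_of_printedNT`: the same with the hypothesis spelled out VERBATIM as the printed Theorem 1 (the
  hypothesis `h` of `NairTenenbaum1998_theorem1.henriotForm_of_printed`), for consumers that avoid the named `def`.
-/

open Filter Finset Polynomial
open scoped BigOperators Topology Classical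

namespace Summit.Parity.BatemanHorn.Cruxes.LSDRealSegment.ProductAnatomySubcritical

open Literature.NumberTheory.Sieve
open Literature.NumberTheory.DiophantineApproximation
open ArithmeticFunction (cardFactors)
noncomputable section

/-- **tailsTwo_aPrioriBound_printed** (helper of `stub_tailsTwo`, line `product-anatomy-subcritical`; CONDITIONAL on the
named fact `NairTenenbaum1998_theorem1_printed`, Nair–Tenenbaum 1998 Thm 1 AS PRINTED): clause (a) of `stub_tailsTwo` —
`APrioriBound k f y` for every Bateman–Horn system of total degree `2` and every `1 ≤ y < 2`
(`tailsTwo_aPrioriBound_of_engine` fed with `tailsTwo_engine_printed` at `B = 1`). [folklore] -/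
theorem tailsTwo_aPrioriBound_printed : NairTenenbaum1998_theorem1_printed →
    ∀ (k : ℕ) (f : Fin k → ℤ[X]), IsBatemanHornSystem f → (∑ i, (f i).natDegree) = 2 →
    ∀ y : ℝ, 1 ≤ y → y < 2 → APrioriBound k f y :=
  fun hP k f hf hdeg y hy hy2 =>
    tailsTwo_aPrioriBound_of_engine k f hf hdeg y hy hy2
      fun A P hA => tailsTwo_engine_printed hP k f hf hdeg y A 1 P hy hy2 hA le_rfl

/-- **tailsTwo_rankinTail_printed** (helper of `stub_tailsTwo`, line `product-anatomy-subcritical`; CONDITIONAL on the named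
fact `NairTenenbaum1998_theorem1_printed`, Nair–Tenenbaum 1998 Thm 1 AS PRINTED): clause (b) of `stub_tailsTwo` —
`RankinTail k f y` for every Bateman–Horn system of total degree `2` and every `1 ≤ y < 2`
(`tailsTwo_rankinTail_of_engine` fed with `tailsTwo_engine_printed` and `tailsTwo_aPrioriBound_printed`). [folklore] -/
theorem tailsTwo_rankinTail_printed : NairTenenbaum1998_theorem1_printed →
    ∀ (k : ℕ) (f : Fin k → ℤ[X]), IsBatemanHornSystem f → (∑ i, (f i).natDegree) = 2 →
    ∀ y : ℝ, 1 ≤ y → y < 2 → RankinTail k f y :=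
  fun hP k f hf hdeg y hy hy2 =>
    tailsTwo_rankinTail_of_engine k f hf hdeg y hy hy2
      (fun A P hA => tailsTwo_engine_printed hP k f hf hdeg y A 1 P hy hy2 hA le_rfl)
      (tailsTwo_aPrioriBound_printed hP k f hf hdeg y hy hy2)

/-- **tailsTwo_topClassBound_printed** (helper of `stub_tailsTwo`, line `product-anatomy-subcritical`; CONDITIONAL on the
named fact `NairTenenbaum1998_theorem1_printed`, Nair–Tenenbaum 1998 Thm 1 AS PRINTED): clause (c) of `stub_tailsTwo` —
`TopClassBound k f y` for every Bateman–Horn system of total degree `2` and every `1 ≤ y < 2`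
(`tailsTwo_topClassBound_of_engine` fed with `tailsTwo_engine_printed` and `tailsTwo_aPrioriBound_printed`). [folklore] -/
theorem tailsTwo_topClassBound_printed : NairTenenbaum1998_theorem1_printed →
    ∀ (k : ℕ) (f : Fin k → ℤ[X]), IsBatemanHornSystem f → (∑ i, (f i).natDegree) = 2 →
    ∀ y : ℝ, 1 ≤ y → y < 2 → TopClassBound k f y :=
  fun hP k f hf hdeg y hy hy2 =>
    tailsTwo_topClassBound_of_engine k f hf hdeg y hy hy2
      (fun A P hA => tailsTwo_engine_printed hP k f hf hdeg y A 1 P hy hy2 hA le_rfl)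
      (tailsTwo_aPrioriBound_printed hP k f hf hdeg y hy hy2)

/-- **tailsTwo_balanced_quadratic_printed** (helper of `stub_tailsTwo`, line `product-anatomy-subcritical`; CONDITIONAL on
the named fact `NairTenenbaum1998_theorem1_printed`, Nair–Tenenbaum 1998 Thm 1 AS PRINTED): clause (d) of `stub_tailsTwo`
for a one-member system of degree `2` — `BalancedClassBound k f y`, `k = 1`, `1 ≤ y < 2`
(`tailsTwo_balanced_quadratic_of_engine` fed with `tailsTwo_engine_printed` and `tailsTwo_aPrioriBound_printed`).
[folklore] -/
theorem tailsTwo_balanced_quadratic_printed : NairTenenbaum1998_theorem1_printed →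
    ∀ (k : ℕ) (f : Fin k → ℤ[X]), IsBatemanHornSystem f → (∑ i, (f i).natDegree) = 2 → k = 1 →
    ∀ y : ℝ, 1 ≤ y → y < 2 → BalancedClassBound k f y :=
  fun hP k f hf hdeg hk y hy hy2 =>
    tailsTwo_balanced_quadratic_of_engine k f hf hdeg hk y hy hy2
      (fun A P hA => tailsTwo_engine_printed hP k f hf hdeg y A 1 P hy hy2 hA le_rfl)
      (tailsTwo_aPrioriBound_printed hP k f hf hdeg y hy hy2)

/-- **tailsTwo_balancedClassBound_printed** (helper of `stub_tailsTwo`, line `product-anatomy-subcritical`; CONDITIONAL on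
the named fact `NairTenenbaum1998_theorem1_printed`, Nair–Tenenbaum 1998 Thm 1 AS PRINTED): clause (d) of `stub_tailsTwo` —
`BalancedClassBound k f y` for every Bateman–Horn system of total degree `2` and every `1 ≤ y < 2`.  Re-basing of
`tailsTwo_balancedClassBound_of_facts` (same proof: one quadratic by `tailsTwo_balanced_quadratic_printed`, a linear pair
through `balanced_subset_top_of_linear` and `tailsTwo_topClassBound_printed`). [folklore] -/
theorem tailsTwo_balancedClassBound_printed : NairTenenbaum1998_theorem1_printed →
    ∀ (k : ℕ) (f : Fin k → ℤ[X]), IsBatemanHornSystem f → (∑ i, (f i).natDegree) = 2 →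
    ∀ y : ℝ, 1 ≤ y → y < 2 → BalancedClassBound k f y := by
  intro hP k f hf hdeg y hy hy2
  rcases eq_one_or_two_of_sum_natDegree hf hdeg with hk | hk
  · exact tailsTwo_balanced_quadratic_printed hP k f hf hdeg hk y hy hy2
  · -- a linear pair: every member has degree `1`
    have hlin : ∀ i, (f i).natDegree = 1 := by
      subst hk
      intro i
      have h0 := hf.natDegree_pos 0
      have h1 := hf.natDegree_pos 1
      rw [Fin.sum_univ_two] at hdeg
      fin_cases i <;> simp <;> omega
    intro ε hε
    obtain ⟨η, hη, hev⟩ := tailsTwo_topClassBound_printed hP k f hf hdeg y hy hy2 ε hε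
    refine ⟨η, hη, ?_⟩
    filter_upwards [hev] with x hx
    exact le_trans (Finset.sum_le_sum_of_subset_of_nonneg (balanced_subset_top_of_linear hlin x η)
      fun n _ _ => by positivity) hx

/-- **stub_tailsTwo_of_NT_printed** (registered helper of `stub_tailsTwo`, line `product-anatomy-subcritical`; THE
CONDITIONAL FORM OF THE STUB on the corrected named fact): assuming `NairTenenbaum1998_theorem1_printed` (Nair–Tenenbaum
1998, Thm 1 p. 125 AS PRINTED — Henriot's form on `0 < α < 1/2`, used at `α = 1/4`), all four tail clauses of
`stub_tailsTwo` hold for every Bateman–Horn system of total degree `2` and every `1 ≤ y < 2`; the second input of the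
landed `stub_tailsTwo_of_facts`, Bugeaud–Evertse–Győry 2018 Thm 2.1 (i), is discharged by the tree's proof
`BugeaudEvertseGyory2018_SPartPolynomialValues_holds` inside `tailsTwo_engine_printed`. [folklore] -/
theorem stub_tailsTwo_of_NT_printed : NairTenenbaum1998_theorem1_printed →
    ∀ (k : ℕ) (f : Fin k → ℤ[X]), IsBatemanHornSystem f → (∑ i, (f i).natDegree) = 2 → ∀ y : ℝ, 1 ≤ y → y < 2 →
      APrioriBound k f y ∧ RankinTail k f y ∧ TopClassBound k f y ∧ BalancedClassBound k f y :=
  fun hP k f hf hdeg y hy hy2 =>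
    ⟨tailsTwo_aPrioriBound_printed hP k f hf hdeg y hy hy2, tailsTwo_rankinTail_printed hP k f hf hdeg y hy hy2,
      tailsTwo_topClassBound_printed hP k f hf hdeg y hy hy2, tailsTwo_balancedClassBound_printed hP k f hf hdeg y hy hy2⟩

/-- **stub_tailsTwo_of_printedNT** (helper of `stub_tailsTwo`, line `product-anatomy-subcritical`): the conditional form of
the stub with its single hypothesis — Nair–Tenenbaum 1998, Theorem 1 (p. 125) AS PRINTED, for pairwise coprime
irreducible `Qⱼ` — SPELLED OUT verbatim (it is, word for word, the hypothesis `h` of the proved bridge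
`NairTenenbaum1998_theorem1.henriotForm_of_printed` and the body of the named fact `NairTenenbaum1998_theorem1_printed`):
for `k ≥ 1`, `A, B ≥ 1`, `0 < ε < 1/(8g²)`, `0 < δ < 1` there are `c₀, C` such that for every such system `Q` of total
degree `g` and discriminant `D`, every `F ∈ 𝓜_k(A, B, εδ/3)` and `x ≥ c₀‖Q‖^δ`, `x^{4g²ε} ≤ y ≤ x`,
`Σ_{x<n≤x+y, Q(n)≠0} F(|Q₁(n)|,…,|Q_k(n)|) ≤ C y ∏_{p≤x}(1 − ρ(p)/p) Σ_{∏nⱼ≤x} F(n) ∏ⱼ ρ_{Qⱼ}(nⱼ)/nⱼ`.  Under it, all four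
tail clauses of `stub_tailsTwo` hold for every Bateman–Horn system of total degree `2` and every `1 ≤ y < 2` (source of
the hypothesis: M. Nair, G. Tenenbaum, Acta Math. 180 (1998), Theorem 1, p. 125). [folklore] -/
theorem stub_tailsTwo_of_printedNT :
    (∀ (k g : ℕ) (D : ℤ) (A B ε δ : ℝ), 1 ≤ k → 1 ≤ A → 1 ≤ B → 0 < ε →
      ε < 1 / (8 * (g : ℝ) ^ 2) → 0 < δ → δ < 1 →
      ∃ c₀ C : ℝ, ∀ Q : Fin k → ℤ[X], (∀ j, Irreducible (Q j)) →
        (∀ i j, i ≠ j →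
          IsCoprime ((Q i).map (Int.castRingHom ℚ)) ((Q j).map (Int.castRingHom ℚ))) →
        HasNoFixedPrimeDivisor Q → (∏ j, Q j).natDegree = g → (∏ j, Q j).discr = D →
        ∀ F : (Fin k → ℕ) → ℝ, IsClassMk k A B (ε * δ / 3) F →
          ∀ x y : ℝ, c₀ * (polyHeight (∏ j, Q j) : ℝ) ^ δ ≤ x → x ^ (4 * (g : ℝ) ^ 2 * ε) ≤ y →
            y ≤ x →
            ∑ n ∈ (Finset.Ioc ⌊x⌋₊ ⌊x + y⌋₊).filter (fun n : ℕ => (∏ j, Q j).eval (n : ℤ) ≠ 0),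
                F (fun j => ((Q j).eval (n : ℤ)).natAbs) ≤
              C * y * (∏ p ∈ (Finset.Icc 1 ⌊x⌋₊).filter Nat.Prime,
                  (1 - (polyRootCountMod Q p : ℝ) / p)) *
                ∑ n ∈ (Fintype.piFinset fun _ : Fin k => Finset.Icc 1 ⌊x⌋₊).filter
                    (fun n => ∏ j, n j ≤ ⌊x⌋₊),
                  F n * ∏ j, ((polyRootCountMod ![Q j] (n j) : ℝ) / (n j))) →
    ∀ (k : ℕ) (f : Fin k → ℤ[X]), IsBatemanHornSystem f → (∑ i, (f i).natDegree) = 2 → ∀ y : ℝ, 1 ≤ y → y < 2 →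
      APrioriBound k f y ∧ RankinTail k f y ∧ TopClassBound k f y ∧ BalancedClassBound k f y :=
  fun h => stub_tailsTwo_of_NT_printed h

end

end Summit.Parity.BatemanHorn.Cruxes.LSDRealSegment.ProductAnatomySubcritical
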